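import Literature.MathematicalPhysics.QuantumFieldTheory.Balaban1983to89.BlockAveragingTwoLevelHaarAC
import Literature.MathematicalPhysics.QuantumFieldTheory.Balaban1983to89.BlockAveragingEMLHaarAC

/-!
# `HaarAC` for Bałaban's TWO-LEVEL block averaging (0.11)–(0.12) with the PRINTED exp-mean-log average on `SU(2)`

`BlockAveragingTwoLevelHaarAC` proved the measure-theoretic residual `HaarAC` of `T4FiniteEpsInhabited` (the push-forward of
product Haar measure under the averaging function `Ū : T^{(j)} → T^{(j+1)}` is absolutely continuous) for the two-level block
averaging (0.11)–(0.12) of [Balaban1987RG1] pp. 253–254 (`BlockAveragingTwoLevel.avgFun₂ M ℰ`: an axiomatic inner group average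
`M` of the contour variables, an outer small-loop average `ℰ` of the loop variables) when the OUTER average is the quaternionic
projected mean `su2Mean`; `BlockAveragingEMLHaarAC` proved it for the one-level averaging (0.4) driven by the PRINTED small-loop
average `ExpMeanLog.expMeanLogSU` (`exp[i Σ |I|⁻¹ (1/i) log W_i]` with the series logarithm, guarded by `‖W_i − 1‖ < δ_N`, value
`1` off the guard).  This module proves it for the two-level averaging (0.12) with the PRINTED outer average `expMeanLogSU` and
EVERY inner group average `M` with measurable `M`, on `SU(2)` (`haarAC_avgFun₂_expMeanLogSU`), and draws the inhabitation
corollary (`exists_blockAvg₂_expMeanLogSU`): the architecture of `BlockAveragingEMLHaarAC` (W-coordinate normal form + splice +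
triangular push-forward, reduction to ONE family of guarded one-variable laws) re-run over the two-level normal form of
`BlockAveragingTwoLevelHaarAC` §§1–2, discharged on `SU(2)` by the same fibre lemma
`T4EMLFibreAC.haarData_restrict_map_absolutelyContinuous_expMeanLog`.

## The argument

§1 (every group `G`, every inner average `M`, every outer average `ℰ`).  In the private coordinate `g = U(β(c))` of
`BlockAveragingHaarAC` put `W := U′(c) = pre · g · post` (`BlockAveragingHaarAC.axialAvg_update_centralBond`).  By FACTS (A), (B)
of `BlockAveragingTwoLevelHaarAC` (`openHol₂_update_of_not_isCentralPt`, `openHol₂_of_isCentralPt` — the latter for EVERY `M`,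
the two central involutions `z_M` cancelling) the loop variables of (0.12) at `c` become `V_r · W⁻¹` at the NON-CENTRAL points
`x ∈ B(c₋)` (`V_r` = the open part `BlockAveragingTwoLevelHaarAC.openHol₂`, free of `g`) and `1` at the central ones: the
W-COORDINATE FAMILY `fibreFamily₂` (`loopHol₂_update_centralBond_self`).  The small-field domain `Small₂` of (0.12) has, besides
the loop-size conjunct, two `M`-ADMISSIBILITY conjuncts on the staircase families at `c₋` and `c₊`; these do not see `U(β(c))`
(`BlockAveragingTwoLevelHaarAC.stairHol_update_centralBond`), so in the coordinate `W` they are a `W`-FREE proposition `AdmAt`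
(`small₂_update_centralBond_self_iff`).  Hence `Ū′(c) = fibreMap₂ W` (`avgFun₂_update_centralBond_self`) with
`fibreMap₂ W = ℰ.avg (fibreFamily₂ W) · W` on the guard `fibreGuard₂ = {W | AdmAt ∧ ∀ r, dist1 (fibreFamily₂ W r) < δ}` and
`fibreMap₂ W = W` off it; two-sided invariance of Haar measure (`BlockAveragingEMLHaarAC.map_haar_mul_mul`), the splice lemma
(`BlockAveragingEMLHaarAC.absolutelyContinuous_map_of_restrict`), the locality of `Ū` (`BlockAveragingTwoLevelHaarAC.isLocal_avgFun₂`),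
the injectivity of `β` and the triangular push-forward lemma `T4TriangularPushforward.map_pi_absolutelyContinuous_pi` reduce
`HaarAC (avgFun₂ M ℰ)` to the absolute continuity of the GUARDED FIBRE LAWS
`((Haar).restrict fibreGuard₂).map (W ↦ ℰ.avg (fibreFamily₂ W) · W)` (`haarAC_avgFun₂_of_guard`).

§2 (`SU(N)`, `ℰ = expMeanLogSU`, every `M`).  On the guard the average IS the printed exponential
(`BlockAveragingEMLHaarAC.coe_avg_expMeanLogSU`), the central terms vanish (`log 1 = 0`) and `V_r W⁻¹ = V_r W*`, so the guarded
fibre map is `W ↦ exp(Σ_x |B|⁻¹ log(V_x W*)) · W` over the non-central points `x` (`coe_fibreCore₂_eq`), whose number is `< |B|`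
(`card_offPt_lt`: the centre is central, `BlockAveragingTwoLevelHaarAC.nCentral₂_pos`) — weights `|B|⁻¹ ≥ 0` of total `< 1`
(`sum_emlWeight₂_lt_one`) — with `‖V_x W* − 1‖ < δ_N ≤ 1/3` on the guard (`norm_offHol₂_mul_star_sub_one_lt`); and the guard is
open (`isOpen_fibreGuard₂`: an open set cut by the `W`-free proposition `AdmAt`).

§3 (`SU(2)`).  These are exactly the hypotheses of `T4EMLFibreAC.haarData_restrict_map_absolutelyContinuous_expMeanLog`
(`haar_restrict_fibreGuard₂_map_absolutelyContinuous`), whence `HaarAC (avgFun₂ M expMeanLogSU)` on every torus in the standing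
range for every `M` with measurable `M` (`haarAC_avgFun₂_expMeanLogSU_of_le`, `haarAC_avgFun₂_expMeanLogSU`), the inhabitation
corollaries, and the instances at the projected inner mean `su2GroupMean`.

## What this is NOT

As in `BlockAveragingTwoLevelHaarAC`: the corollary `exists_blockAvg₂_expMeanLogSU` inhabits the CARRIER `FiniteEpsData F SU(2)`
with data averaging by (0.12) with the printed outer average; the inhabitant is the STUB of `T4FiniteEpsInhabited` §3
(placeholder `Realisation`), at which the pinned end statement (B) of the cell FAILS (`not_endStatementBPrinted_blockAvg₂EML_stub`).
Nothing here is progress on the continuum limit (Theorems 1–2 of [Balaban1987RG1]) or on the summit: the node is OFF the spine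
of the cell's T4 DAG, and every result is elementary measure theory ([folklore]) about the published formulas (0.11)–(0.12)
pp. 253–254, whose citations are carried by `BlockAveragingTwoLevel` (nothing printed is asserted here; no new citation).
`SU(N)` for `N ≥ 3` is not treated (the fibre lemma of `T4EMLFibreAC` is quaternionic); §§1–2 hold for every group, resp.
every `SU(N)`.  The INNER average `M` stays axiomatic (`BlockAveragingTwoLevel.GroupAverage`), exactly as in
`BlockAveragingTwoLevelHaarAC`.

## Versions

* v1: the module.
-/

noncomputable section

open MeasureTheory Function NormedSpace

namespace Literature.MathematicalPhysics.QuantumFieldTheory.Balaban1983to89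

namespace BlockAveragingTwoLevelEMLHaarAC

open T4Continuum AveragingRT BlockAveraging BlockAveragingHaarAC BlockAveragingTwoLevel BlockAveragingTwoLevelHaarAC
open BlockAveragingEMLHaarAC (absolutelyContinuous_map_of_restrict map_haar_mul_mul coe_avg_expMeanLogSU)

/-! ## 1. Every group, every inner average `M`, every outer average `ℰ`: the W-coordinate normal form of (0.12) and the
reduction to guarded fibre laws -/

section Fibre

variable {P : Params} {j : ℕ} {G : Type*} [GaugeGroup G] (𝓜 : GroupAverage G)

/-- **THE W-COORDINATE FAMILY OF (0.12)** at `c`: `1` at the central points, `V_r · W⁻¹` (open part times the inverse of the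
coarse bond variable `W = U′(c)`) at the non-central ones. [folklore] -/
def fibreFamily₂ (U : GaugeField P j G) (c : PBond P (j+1)) (W : G) (r : Pt P) : G :=
  if IsCentralPt c r then 1 else openHol₂ 𝓜 U c r * W⁻¹

/-- At a central point the W-coordinate family is `1`. [folklore] -/
theorem fibreFamily₂_of_isCentralPt (U : GaugeField P j G) (c : PBond P (j+1)) (W : G) (r : Pt P) (h : IsCentralPt c r) :
    fibreFamily₂ 𝓜 U c W r = 1 := by
  unfold fibreFamily₂; rw [if_pos h]

/-- At a non-central point the W-coordinate family is `V_r · W⁻¹`. [folklore] -/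
theorem fibreFamily₂_of_not_isCentralPt (U : GaugeField P j G) (c : PBond P (j+1)) (W : G) (r : Pt P)
    (h : ¬ IsCentralPt c r) : fibreFamily₂ 𝓜 U c W r = openHol₂ 𝓜 U c r * W⁻¹ := by
  unfold fibreFamily₂; rw [if_neg h]

/-- **THE LOOP VARIABLES OF (0.12) IN THE PRIVATE COORDINATE**: for `U′ = U[β(c) ↦ g]` the family of loop variables at `c` is
the W-coordinate family at `W = U′(c) = pre · g · post` (FACTS (A), (B) of `BlockAveragingTwoLevelHaarAC`, every `M`). [folklore] -/
theorem loopHol₂_update_centralBond_self [DecidableEq (PBond P j)] (hj : j + 1 ≤ P.m + P.K) (U : GaugeField P j G)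
    (c : PBond P (j+1)) (g : G) :
    loopHol₂ 𝓜 (update U (centralBond c) g) c = fibreFamily₂ 𝓜 U c (pre U c * g * post U c) := by
  funext r
  rw [loopHol₂_eq_openHol₂_mul, axialAvg_update_centralBond hj]
  by_cases h : IsCentralPt c r
  · rw [fibreFamily₂_of_isCentralPt 𝓜 U c _ r h, openHol₂_of_isCentralPt 𝓜 _ c r h, axialAvg_update_centralBond hj,
      mul_inv_cancel]
  · rw [fibreFamily₂_of_not_isCentralPt 𝓜 U c _ r h, openHol₂_update_of_not_isCentralPt 𝓜 hj U c r h g]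

/-- **THE `M`-ADMISSIBILITY CONJUNCTS** of the small-field domain of (0.12) at `c` (the staircase families at `c₋` and at `c₊`
are admissible for `M`): the `W`-FREE part of the guard. [folklore] -/
def AdmAt (U : GaugeField P j G) (c : PBond P (j+1)) : Prop :=
  (∀ r : Pt P, 𝓜.Adm (stairHol U c.src (off r))) ∧ ∀ r : Pt P, 𝓜.Adm (stairHol U c.tgt (off r))

/-- The admissibility conjuncts do not see `U(β(c))`. [folklore] -/
theorem admAt_update_centralBond_iff [DecidableEq (PBond P j)] (hj : j + 1 ≤ P.m + P.K) (U : GaugeField P j G)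
    (c : PBond P (j+1)) (g : G) : AdmAt 𝓜 (update U (centralBond c) g) c ↔ AdmAt 𝓜 U c := by
  unfold AdmAt
  simp only [stairHol_update_centralBond hj]

variable (ℰ : LoopAverage G)

/-- The small-field guard of (0.12) in the W-coordinate: admissibility and `dist1 < δ` of the W-coordinate family. [folklore] -/
def FibreSmall₂ (U : GaugeField P j G) (c : PBond P (j+1)) (W : G) : Prop :=
  AdmAt 𝓜 U c ∧ ∀ r, dist1 (fibreFamily₂ 𝓜 U c W r) < ℰ.δ

/-- The small-field guard in the W-coordinate, as a set. [folklore] -/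
def fibreGuard₂ (U : GaugeField P j G) (c : PBond P (j+1)) : Set G :=
  {W | FibreSmall₂ 𝓜 ℰ U c W}

open scoped Classical in
/-- **THE FIBRE MAP OF (0.12)** `W ↦ Ū′(c)`: `ℰ.avg (fibreFamily₂ W) · W` on the guard, `W` off it. [folklore] -/
def fibreMap₂ (U : GaugeField P j G) (c : PBond P (j+1)) (W : G) : G :=
  (if FibreSmall₂ 𝓜 ℰ U c W then ℰ.avg (fibreFamily₂ 𝓜 U c W) else 1) * W

/-- The guard of (0.12) at `U′ = U[β(c) ↦ g]` is the W-coordinate guard at `W = pre · g · post`. [folklore] -/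
theorem small₂_update_centralBond_self_iff [DecidableEq (PBond P j)] (hj : j + 1 ≤ P.m + P.K) (U : GaugeField P j G)
    (c : PBond P (j+1)) (g : G) :
    Small₂ 𝓜 ℰ (update U (centralBond c) g) c ↔ FibreSmall₂ 𝓜 ℰ U c (pre U c * g * post U c) := by
  have h := admAt_update_centralBond_iff 𝓜 hj U c g
  unfold AdmAt at h
  unfold Small₂ FibreSmall₂ AdmAt
  rw [loopHol₂_update_centralBond_self 𝓜 hj U c g, ← and_assoc, h]

/-- **THE ONE-VARIABLE NORMAL FORM OF (0.12)**: `Ū′(c) = fibreMap₂ (pre · g · post)` for `U′ = U[β(c) ↦ g]`, for every inner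
and every outer average. [folklore] -/
theorem avgFun₂_update_centralBond_self [DecidableEq (PBond P j)] (hj : j + 1 ≤ P.m + P.K) (U : GaugeField P j G)
    (c : PBond P (j+1)) (g : G) :
    avgFun₂ 𝓜 ℰ (update U (centralBond c) g) c = fibreMap₂ 𝓜 ℰ U c (pre U c * g * post U c) := by
  show corr₂ 𝓜 ℰ _ c * axialAvg _ c = _
  unfold corr₂ fibreMap₂
  rw [small₂_update_centralBond_self_iff 𝓜 ℰ hj, loopHol₂_update_centralBond_self 𝓜 hj, axialAvg_update_centralBond hj]

/-- On the guard the fibre map is `ℰ.avg (fibreFamily₂ W) · W`. [folklore] -/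
theorem fibreMap₂_of_mem (U : GaugeField P j G) (c : PBond P (j+1)) {W : G} (hW : W ∈ fibreGuard₂ 𝓜 ℰ U c) :
    fibreMap₂ 𝓜 ℰ U c W = ℰ.avg (fibreFamily₂ 𝓜 U c W) * W := by
  have h : FibreSmall₂ 𝓜 ℰ U c W := hW
  unfold fibreMap₂; rw [if_pos h]

/-- Off the guard the fibre map is the identity. [folklore] -/
theorem fibreMap₂_of_not_mem (U : GaugeField P j G) (c : PBond P (j+1)) {W : G} (hW : W ∉ fibreGuard₂ 𝓜 ℰ U c) :
    fibreMap₂ 𝓜 ℰ U c W = W := by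
  have h : ¬ FibreSmall₂ 𝓜 ℰ U c W := hW
  unfold fibreMap₂; rw [if_neg h, one_mul]

/-- The guard is the `W`-free proposition `AdmAt` cut with the finite intersection of the loop-size conditions. [folklore] -/
theorem fibreGuard₂_eq (U : GaugeField P j G) (c : PBond P (j+1)) :
    fibreGuard₂ 𝓜 ℰ U c = {_W | AdmAt 𝓜 U c} ∩ ⋂ r, {W : G | dist1 (fibreFamily₂ 𝓜 U c W r) < ℰ.δ} := by
  ext W; simp [fibreGuard₂, FibreSmall₂]

omit ℰ in
/-- The number of non-central points of `B(c₋)` is `< |B(c₋)|` (the centre is central, `nCentral₂_pos`). [folklore] -/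
theorem card_offPt_lt (c : PBond P (j+1)) : Fintype.card {r : Pt P // ¬ IsCentralPt c r} < Fintype.card (Pt P) := by
  obtain ⟨r₀, hr₀⟩ := Finset.card_pos.mp (nCentral₂_pos c)
  exact Fintype.card_subtype_lt (p := fun r => ¬ IsCentralPt c r) (not_not.mpr (Finset.mem_filter.mp hr₀).2)

omit ℰ in
/-- The non-central open parts `V_x`, indexed by the non-central points. [folklore] -/
def offHol₂ (U : GaugeField P j G) (c : PBond P (j+1)) (x : {r : Pt P // ¬ IsCentralPt c r}) : G := openHol₂ 𝓜 U c x.1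

omit 𝓜 ℰ in
/-- The uniform weight `|B(c₋)|⁻¹ = L^{-d}` of (0.12). [folklore] -/
def emlWeight₂ (P : Params) : ℝ := ((Fintype.card (Pt P) : ℝ))⁻¹

omit 𝓜 ℰ in
/-- `|B|⁻¹ ≥ 0`. [folklore] -/
theorem emlWeight₂_nonneg (P : Params) : 0 ≤ emlWeight₂ P := inv_nonneg.mpr (Nat.cast_nonneg _)

omit 𝓜 ℰ in
/-- The total weight of the non-central points is `< 1`. [folklore] -/
theorem sum_emlWeight₂_lt_one (c : PBond P (j+1)) : ∑ _x : {r : Pt P // ¬ IsCentralPt c r}, emlWeight₂ P < 1 := by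
  rw [Finset.sum_const, Finset.card_univ, nsmul_eq_mul, emlWeight₂, ← div_eq_mul_inv,
    div_lt_one (Nat.cast_pos.mpr Fintype.card_pos)]
  exact_mod_cast card_offPt_lt c

end Fibre

section Meas

variable {P : Params} {j : ℕ} {G : Type*} [GaugeGroup G] [MeasurableSpace G] [RegularGaugeGroup G] (𝓜 : GroupAverage G)
  (ℰ : LoopAverage G)

omit ℰ in
/-- The W-coordinate family is measurable in `W`. [folklore] -/
theorem measurable_fibreFamily₂ (U : GaugeField P j G) (c : PBond P (j+1)) : Measurable (fibreFamily₂ 𝓜 U c) := by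
  refine measurable_pi_lambda _ fun r => ?_
  by_cases h : IsCentralPt c r
  · simp only [fibreFamily₂, if_pos h]
    exact measurable_const
  · simp only [fibreFamily₂, if_neg h]
    exact measurable_const.mul measurable_inv

/-- The W-coordinate guard is measurable. [folklore] -/
theorem measurableSet_fibreGuard₂ (U : GaugeField P j G) (c : PBond P (j+1)) : MeasurableSet (fibreGuard₂ 𝓜 ℰ U c) := by
  rw [fibreGuard₂_eq]
  exact (MeasurableSet.const _).inter (MeasurableSet.iInter fun r =>
    measurableSet_lt (RegularGaugeGroup.measurable_dist1.comp ((measurable_pi_apply r).comp (measurable_fibreFamily₂ 𝓜 U c)))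
      measurable_const)

/-- The guarded branch `W ↦ ℰ.avg (fibreFamily₂ W) · W` of the fibre map is measurable (given a measurable `ℰ`). [folklore] -/
theorem measurable_fibreCore₂ (hE : ℰ.MeasurableE) (U : GaugeField P j G) (c : PBond P (j+1)) :
    Measurable fun W : G => ℰ.avg (fibreFamily₂ 𝓜 U c W) * W :=
  ((ℰ.measurable_avg hE).comp (measurable_fibreFamily₂ 𝓜 U c)).mul measurable_id

/-- The fibre map is measurable (given a measurable `ℰ`). [folklore] -/
theorem measurable_fibreMap₂ (hE : ℰ.MeasurableE) (U : GaugeField P j G) (c : PBond P (j+1)) :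
    Measurable (fibreMap₂ 𝓜 ℰ U c) := by
  show Measurable fun W => fibreMap₂ 𝓜 ℰ U c W
  unfold fibreMap₂
  exact (Measurable.ite (measurableSet_fibreGuard₂ 𝓜 ℰ U c) ((ℰ.measurable_avg hE).comp (measurable_fibreFamily₂ 𝓜 U c))
    measurable_const).mul measurable_id

end Meas

section Law

variable {P : Params} {j : ℕ} {G : Type*} [GaugeGroup G] [MeasurableSpace G] [RegularGaugeGroup G] [HaarData G]
  (𝓜 : GroupAverage G) (ℰ : LoopAverage G)

/-- **THE ONE-VARIABLE LAW OF (0.12) IS THE LAW OF THE FIBRE MAP**: the law of `Ū′(c)`, `U′ = U[β(c) ↦ g]`, under Haar measure in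
`g` is the push-forward of Haar measure under `fibreMap₂`. [folklore] -/
theorem map_haar_avgFun₂_update_eq [DecidableEq (PBond P j)] (hj : j + 1 ≤ P.m + P.K) (hE : ℰ.MeasurableE)
    (U : GaugeField P j G) (c : PBond P (j+1)) :
    (HaarData.haar : Measure G).map (fun g => avgFun₂ 𝓜 ℰ (update U (centralBond c) g) c) =
      (HaarData.haar : Measure G).map (fibreMap₂ 𝓜 ℰ U c) := by
  have h1 : (fun g => avgFun₂ 𝓜 ℰ (update U (centralBond c) g) c) = fibreMap₂ 𝓜 ℰ U c ∘ fun g => pre U c * g * post U c :=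
    funext fun g => avgFun₂_update_centralBond_self 𝓜 ℰ hj U c g
  rw [h1, ← Measure.map_map (measurable_fibreMap₂ 𝓜 ℰ hE U c) ((measurable_const_mul _).mul_const _), map_haar_mul_mul]

/-- The one-variable law of (0.12) is absolutely continuous as soon as the GUARDED FIBRE LAW
`((Haar).restrict fibreGuard₂).map (W ↦ ℰ.avg (fibreFamily₂ W) · W)` is. [folklore] -/
theorem map_haar_avgFun₂_update_absolutelyContinuous_of_guard [DecidableEq (PBond P j)] (hj : j + 1 ≤ P.m + P.K)
    (hE : ℰ.MeasurableE) (U : GaugeField P j G) (c : PBond P (j+1))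
    (hac : ((HaarData.haar : Measure G).restrict (fibreGuard₂ 𝓜 ℰ U c)).map (fun W => ℰ.avg (fibreFamily₂ 𝓜 U c W) * W) ≪
      HaarData.haar) :
    (HaarData.haar : Measure G).map (fun g => avgFun₂ 𝓜 ℰ (update U (centralBond c) g) c) ≪ HaarData.haar := by
  rw [map_haar_avgFun₂_update_eq 𝓜 ℰ hj hE U c]
  refine absolutelyContinuous_map_of_restrict (measurable_fibreMap₂ 𝓜 ℰ hE U c)
    (fun W hW => fibreMap₂_of_not_mem 𝓜 ℰ U c hW) ?_
  have heq : ((HaarData.haar : Measure G).restrict (fibreGuard₂ 𝓜 ℰ U c)).map (fibreMap₂ 𝓜 ℰ U c) =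
      ((HaarData.haar : Measure G).restrict (fibreGuard₂ 𝓜 ℰ U c)).map (fun W => ℰ.avg (fibreFamily₂ 𝓜 U c W) * W) :=
    Measure.map_congr ((ae_restrict_iff' (measurableSet_fibreGuard₂ 𝓜 ℰ U c)).mpr
      (ae_of_all _ fun W hW => fibreMap₂_of_mem 𝓜 ℰ U c hW))
  rw [heq]
  exact hac

/-- **REDUCTION OF `HaarAC` FOR (0.12) TO THE GUARDED FIBRE LAWS** (every group, every inner average with measurable `M`, every
outer average with measurable `E`), on every torus in the standing range `j + 1 ≤ m + K`: if for every configuration `U` and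
coarse bond `c` the guarded fibre law `((Haar).restrict fibreGuard₂).map (W ↦ ℰ.avg (fibreFamily₂ U c W) · W)` is absolutely
continuous, then the push-forward of product Haar measure under `Ū = avgFun₂ M ℰ` is absolutely continuous — by the triangular
push-forward lemma of `T4TriangularPushforward` in the private coordinates `β` (`BlockAveragingTwoLevelHaarAC.isLocal_avgFun₂`).
[folklore] -/
theorem haarAC_avgFun₂_of_guard (hj : j + 1 ≤ P.m + P.K) (hM : ∀ n, Measurable (fun W : Fin (n+1) → G => 𝓜.M W))
    (hE : ℰ.MeasurableE)
    (hac : ∀ (U : GaugeField P j G) (c : PBond P (j+1)),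
      ((HaarData.haar : Measure G).restrict (fibreGuard₂ 𝓜 ℰ U c)).map (fun W => ℰ.avg (fibreFamily₂ 𝓜 U c W) * W) ≪
        HaarData.haar) :
    T4FiniteEpsInhabited.HaarAC (avgFun₂ 𝓜 ℰ : GaugeField P j G → GaugeField P (j+1) G) := by
  classical
  unfold T4FiniteEpsInhabited.HaarAC fieldMeasure
  exact T4TriangularPushforward.map_pi_absolutelyContinuous_pi (HaarData.haar : Measure G) (isLocal_avgFun₂ 𝓜 ℰ hj)
    (centralBond_injective hj) (measurable_avgFun₂ 𝓜 ℰ hM hE)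
    (fun U c => map_haar_avgFun₂_update_absolutelyContinuous_of_guard 𝓜 ℰ hj hE U c (hac U c))

end Law

/-! ## 2. `SU(N)`: the guarded fibre map of the exp-mean-log outer average is `W ↦ exp(Σ_x |B|⁻¹ log(V_x W*)) · W` -/

section SUN

open ExpMeanLog MatrixLog
open scoped Matrix.Norms.L2Operator

variable {P : Params} {j : ℕ} {n : Type*} [DecidableEq n] [Fintype n] [Nonempty n]
  (𝓜 : GroupAverage (Matrix.specialUnitaryGroup n ℂ))

/-- In the matrix model, the non-central W-coordinate variable is `V_r W*`. [folklore] -/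
theorem coe_fibreFamily₂_of_not_isCentralPt (U : GaugeField P j (Matrix.specialUnitaryGroup n ℂ)) (c : PBond P (j+1))
    (W : Matrix.specialUnitaryGroup n ℂ) (r : Pt P) (h : ¬ IsCentralPt c r) :
    ((fibreFamily₂ 𝓜 U c W r : Matrix.specialUnitaryGroup n ℂ) : Matrix n n ℂ) =
      ((openHol₂ 𝓜 U c r : Matrix.specialUnitaryGroup n ℂ) : Matrix n n ℂ) * star (W : Matrix n n ℂ) := by
  rw [fibreFamily₂_of_not_isCentralPt 𝓜 U c W r h]; rfl

/-- In the matrix model, `dist1 (V_r W⁻¹) = ‖V_r W* − 1‖` at a non-central point. [folklore] -/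
theorem dist1_fibreFamily₂_of_not_isCentralPt (U : GaugeField P j (Matrix.specialUnitaryGroup n ℂ)) (c : PBond P (j+1))
    (W : Matrix.specialUnitaryGroup n ℂ) (r : Pt P) (h : ¬ IsCentralPt c r) :
    dist1 (fibreFamily₂ 𝓜 U c W r) =
      ‖((openHol₂ 𝓜 U c r : Matrix.specialUnitaryGroup n ℂ) : Matrix n n ℂ) * star (W : Matrix n n ℂ) - 1‖ := by
  rw [fibreFamily₂_of_not_isCentralPt 𝓜 U c W r h]; rfl

/-- **THE W-COORDINATE GUARD OF (0.12) IS OPEN** in `SU(N)` (an open set cut by the `W`-free proposition `AdmAt`). [folklore] -/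
theorem isOpen_fibreGuard₂ (U : GaugeField P j (Matrix.specialUnitaryGroup n ℂ)) (c : PBond P (j+1)) :
    IsOpen (fibreGuard₂ 𝓜 (expMeanLogSU (n := n)) U c) := by
  have hδ := (expMeanLogSU (n := n)).δ_pos
  rw [fibreGuard₂_eq]
  refine isOpen_const.inter (isOpen_iInter_of_finite fun r => ?_)
  by_cases h : IsCentralPt c r
  · have huniv : {W : Matrix.specialUnitaryGroup n ℂ | dist1 (fibreFamily₂ 𝓜 U c W r) < (expMeanLogSU (n := n)).δ} = Set.univ :=
      Set.eq_univ_of_forall fun W => by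
        show dist1 (fibreFamily₂ 𝓜 U c W r) < _
        rw [fibreFamily₂_of_isCentralPt 𝓜 U c W r h, GaugeGroup.dist1_one]; exact hδ
    rw [huniv]; exact isOpen_univ
  · have hset' : {W : Matrix.specialUnitaryGroup n ℂ | dist1 (fibreFamily₂ 𝓜 U c W r) < (expMeanLogSU (n := n)).δ} =
        {W : Matrix.specialUnitaryGroup n ℂ |
          ‖((openHol₂ 𝓜 U c r : Matrix.specialUnitaryGroup n ℂ) : Matrix n n ℂ) * star (W : Matrix n n ℂ) - 1‖ <
            (expMeanLogSU (n := n)).δ} := by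
      ext W; rw [Set.mem_setOf_eq, Set.mem_setOf_eq, dist1_fibreFamily₂_of_not_isCentralPt 𝓜 U c W r h]
    rw [hset']
    exact isOpen_lt ((continuous_const.mul continuous_subtype_val.star).sub continuous_const).norm continuous_const

/-- The central terms drop out of the printed sum (`log 1 = 0`): `Σ_r log(fibreFamily₂ W r) = Σ_x log(V_x W*)` over the
non-central points. [folklore] -/
theorem sum_mlog_fibreFamily₂ (U : GaugeField P j (Matrix.specialUnitaryGroup n ℂ)) (c : PBond P (j+1))
    (W : Matrix.specialUnitaryGroup n ℂ) :
    ∑ r, mlog ((fibreFamily₂ 𝓜 U c W r : Matrix.specialUnitaryGroup n ℂ) : Matrix n n ℂ) =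
      ∑ x : {r : Pt P // ¬ IsCentralPt c r},
        mlog (((offHol₂ 𝓜 U c x : Matrix.specialUnitaryGroup n ℂ) : Matrix n n ℂ) * star (W : Matrix n n ℂ)) := by
  rw [← Fintype.sum_subtype_add_sum_subtype (IsCentralPt c)
    (fun r => mlog ((fibreFamily₂ 𝓜 U c W r : Matrix.specialUnitaryGroup n ℂ) : Matrix n n ℂ))]
  have h0 : ∑ x : {r : Pt P // IsCentralPt c r},
      mlog ((fibreFamily₂ 𝓜 U c W x : Matrix.specialUnitaryGroup n ℂ) : Matrix n n ℂ) = 0 :=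
    Fintype.sum_eq_zero _ fun x => by rw [fibreFamily₂_of_isCentralPt 𝓜 U c W x x.2]; exact mlog_one
  rw [h0, zero_add]
  exact Fintype.sum_congr _ _ fun x => by rw [coe_fibreFamily₂_of_not_isCentralPt 𝓜 U c W x x.2, offHol₂]

/-- **THE GUARDED FIBRE MAP OF THE EXP-MEAN-LOG OUTER AVERAGE**: on the guard,
`expMeanLogSU.avg (fibreFamily₂ W) · W = exp(Σ_x |B|⁻¹ log(V_x W*)) · W`. [folklore] -/
theorem coe_fibreCore₂_eq (U : GaugeField P j (Matrix.specialUnitaryGroup n ℂ)) (c : PBond P (j+1))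
    {W : Matrix.specialUnitaryGroup n ℂ} (hW : W ∈ fibreGuard₂ 𝓜 (expMeanLogSU (n := n)) U c) :
    (((expMeanLogSU (n := n)).avg (fibreFamily₂ 𝓜 U c W) * W : Matrix.specialUnitaryGroup n ℂ) : Matrix n n ℂ) =
      exp (∑ x : {r : Pt P // ¬ IsCentralPt c r}, ((emlWeight₂ P : ℝ) : ℂ) •
          mlog (((offHol₂ 𝓜 U c x : Matrix.specialUnitaryGroup n ℂ) : Matrix n n ℂ) * star (W : Matrix n n ℂ)))
        * (W : Matrix n n ℂ) := by
  have hw : ((emlWeight₂ P : ℝ) : ℂ) = ((Fintype.card (Pt P) : ℂ))⁻¹ := by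
    rw [emlWeight₂, Complex.ofReal_inv, Complex.ofReal_natCast]
  have hW' : ∀ r, dist1 (fibreFamily₂ 𝓜 U c W r) < (expMeanLogSU (n := n)).δ := hW.2
  rw [hw, Submonoid.coe_mul, coe_avg_expMeanLogSU _ hW', sum_mlog_fibreFamily₂ 𝓜 U c W, Finset.smul_sum]

/-- On the guard, `‖V_x W* − 1‖ < 1/3` for every non-central `x` (`δ_N ≤ 1/3`). [folklore] -/
theorem norm_offHol₂_mul_star_sub_one_lt (U : GaugeField P j (Matrix.specialUnitaryGroup n ℂ)) (c : PBond P (j+1))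
    {W : Matrix.specialUnitaryGroup n ℂ} (hW : W ∈ fibreGuard₂ 𝓜 (expMeanLogSU (n := n)) U c)
    (x : {r : Pt P // ¬ IsCentralPt c r}) :
    ‖((offHol₂ 𝓜 U c x : Matrix.specialUnitaryGroup n ℂ) : Matrix n n ℂ) * star (W : Matrix n n ℂ) - 1‖ < 1 / 3 := by
  have hW' : ∀ r, dist1 (fibreFamily₂ 𝓜 U c W r) < (expMeanLogSU (n := n)).δ := hW.2
  have hx := hW' x.1
  rw [dist1_fibreFamily₂_of_not_isCentralPt 𝓜 U c W _ x.2] at hx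
  exact lt_third_of_lt_deltaSU hx

end SUN

/-! ## 3. `SU(2)`: the guarded fibre laws are absolutely continuous (`T4EMLFibreAC`), hence `HaarAC` for every inner `M` -/

section SU2

open ExpMeanLog MatrixLog SU2Mean
open scoped Matrix.Norms.L2Operator

variable {P : Params} {j : ℕ} (𝓜 : GroupAverage (Matrix.specialUnitaryGroup (Fin 2) ℂ))

/-- **THE GUARDED FIBRE LAWS OF (0.12) WITH THE EXP-MEAN-LOG OUTER AVERAGE ON `SU(2)` ARE ABSOLUTELY CONTINUOUS**, for every
inner average `M` — the fibre lemma `T4EMLFibreAC.haarData_restrict_map_absolutelyContinuous_expMeanLog` at the open guard, the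
non-central open parts `V_x`, the uniform weights `|B|⁻¹` of total `< 1`, and the normal form `coe_fibreCore₂_eq`. [folklore] -/
theorem haar_restrict_fibreGuard₂_map_absolutelyContinuous (U : GaugeField P j (Matrix.specialUnitaryGroup (Fin 2) ℂ))
    (c : PBond P (j+1)) :
    ((HaarData.haar : Measure (Matrix.specialUnitaryGroup (Fin 2) ℂ)).restrict (fibreGuard₂ 𝓜 expMeanLogSU U c)).map
        (fun W => expMeanLogSU.avg (fibreFamily₂ 𝓜 U c W) * W) ≪ HaarData.haar :=
  T4EMLFibreAC.haarData_restrict_map_absolutelyContinuous_expMeanLog (isOpen_fibreGuard₂ 𝓜 U c) (offHol₂ 𝓜 U c)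
    (c := fun _ => emlWeight₂ P) (fun _ => emlWeight₂_nonneg P) (sum_emlWeight₂_lt_one c)
    (measurable_fibreCore₂ 𝓜 expMeanLogSU measurable_expMeanLogSU_E U c)
    (fun W hW x => (norm_offHol₂_mul_star_sub_one_lt 𝓜 U c hW x).trans (by norm_num))
    (fun W hW => coe_fibreCore₂_eq 𝓜 U c hW)

/-- **`HaarAC` FOR BAŁABAN'S TWO-LEVEL AVERAGING (0.12) WITH THE PRINTED EXP-MEAN-LOG OUTER AVERAGE ON `SU(2)`**, for EVERY inner
group average `M` with measurable `M`, on every torus in the standing range `j + 1 ≤ m + K`: the push-forward of product Haar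
measure under `Ū = avgFun₂ M expMeanLogSU` is absolutely continuous with respect to product Haar measure (stated in `@`-explicit
form, which fixes the torus `P, j` and the group). [folklore] -/
theorem haarAC_avgFun₂_expMeanLogSU_of_le (hj : j + 1 ≤ P.m + P.K)
    (hM : ∀ n, Measurable (fun W : Fin (n+1) → Matrix.specialUnitaryGroup (Fin 2) ℂ => 𝓜.M W)) :
    @T4FiniteEpsInhabited.HaarAC P j (Matrix.specialUnitaryGroup (Fin 2) ℂ) _ _ _ (avgFun₂ 𝓜 expMeanLogSU) :=
  haarAC_avgFun₂_of_guard 𝓜 expMeanLogSU hj hM measurable_expMeanLogSU_E fun U c =>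
    haar_restrict_fibreGuard₂_map_absolutelyContinuous 𝓜 U c

/-- **NODE T4-D.G-EML-2L ON `SU(2)`: `HaarAC` ON EVERY TORUS OF A FAMILY** in the standing range `k < K`, every inner `M` with
measurable `M` — the `k`-th instance of the named residual `BlockHaarAC₂ F M expMeanLogSU` of `T4ApexTwoLevel` §5b at `N = 2`.
[folklore] -/
theorem haarAC_avgFun₂_expMeanLogSU
    (hM : ∀ n, Measurable (fun W : Fin (n+1) → Matrix.specialUnitaryGroup (Fin 2) ℂ => 𝓜.M W)) (F : T4Family) (K k : ℕ)
    (hk : k < K) :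
    @T4FiniteEpsInhabited.HaarAC (F.P K) k (Matrix.specialUnitaryGroup (Fin 2) ℂ) _ _ _ (avgFun₂ 𝓜 expMeanLogSU) :=
  haarAC_avgFun₂_expMeanLogSU_of_le 𝓜 (by show k + 1 ≤ F.m + K; omega) hM

/-- **FINITE-`ε` DATA ON `SU(2)` AVERAGING BY (0.12) WITH THE PRINTED OUTER AVERAGE EXIST**, for every inner `M` with measurable
`M`: `∃ D : FiniteEpsData F SU(2), ∀ K j, D.av K j = blockAvg₂ M expMeanLogSU`.  The inhabitant is the STUB of
`T4FiniteEpsInhabited` §3 (placeholder `Realisation`): carrier inhabitation, not the theorem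
(`not_endStatementBPrinted_blockAvg₂EML_stub`). [cite: Balaban1987RG1, (0.12) p.254] -/
theorem exists_blockAvg₂_expMeanLogSU
    (hM : ∀ n, Measurable (fun W : Fin (n+1) → Matrix.specialUnitaryGroup (Fin 2) ℂ => 𝓜.M W)) (F : T4Family) :
    ∃ D : T4Continuum.FiniteEpsData F (Matrix.specialUnitaryGroup (Fin 2) ℂ), ∀ K j, D.av K j = blockAvg₂ 𝓜 expMeanLogSU :=
  ⟨T4FiniteEpsInhabited.stubData F _ (fun _ _ => blockAvg₂ 𝓜 expMeanLogSU)
      (fun _ _ => measurable_avgFun₂ 𝓜 expMeanLogSU hM measurable_expMeanLogSU_E)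
      (fun K k hk => haarAC_avgFun₂_expMeanLogSU 𝓜 hM F K k hk),
    fun _ _ => rfl⟩

/-- HONEST SCOPE: at the inhabitant just produced the pinned end statement (B) FAILS (`T4FiniteEpsInhabited`). [folklore] -/
theorem not_endStatementBPrinted_blockAvg₂EML_stub
    (hM : ∀ n, Measurable (fun W : Fin (n+1) → Matrix.specialUnitaryGroup (Fin 2) ℂ => 𝓜.M W)) (F : T4Family) :
    ¬ B16.EndStatementBPrinted
      (T4FiniteEpsInhabited.stubData F (Matrix.specialUnitaryGroup (Fin 2) ℂ) (fun _ _ => blockAvg₂ 𝓜 expMeanLogSU)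
        (fun _ _ => measurable_avgFun₂ 𝓜 expMeanLogSU hM measurable_expMeanLogSU_E)
        (fun K k hk => haarAC_avgFun₂_expMeanLogSU 𝓜 hM F K k hk)).C :=
  T4FiniteEpsInhabited.not_endStatementBPrinted_of_stubData F _ _ _ _

/-- Hence finite-`ε` data on `SU(2)` averaging by (0.12) (any measurable inner `M`, printed outer average) EXIST and satisfy the
reflection-positivity and torus-covariance targets in both forms (the discharge theorems of `BlockAveragingTwoLevel` §6, which
carry the citations). [folklore] -/
theorem exists_blockAvg₂_expMeanLogSU_rp_and_cov
    (hM : ∀ n, Measurable (fun W : Fin (n+1) → Matrix.specialUnitaryGroup (Fin 2) ℂ => 𝓜.M W)) (F : T4Family) :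
    ∃ D : T4Continuum.FiniteEpsData F (Matrix.specialUnitaryGroup (Fin 2) ℂ), (∀ K j, D.av K j = blockAvg₂ 𝓜 expMeanLogSU) ∧
      (D.limit_reflectionPositive' ∧ D.limit_reflectionPositive) ∧ (D.limit_torusCovariant' ∧ D.limit_torusCovariant) := by
  obtain ⟨D, hD⟩ := exists_blockAvg₂_expMeanLogSU 𝓜 hM F
  exact ⟨D, hD, D.avg_limit_reflectionPositive_SU
    (D.avgMeasurable_of_blockAvg₂ 𝓜 expMeanLogSU hM measurable_expMeanLogSU_E hD), D.limit_torusCovariant_of_blockAvg₂ _ _ hD⟩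

/-- **`HaarAC` for the two-level averaging with the projected INNER mean `su2GroupMean` and the printed OUTER average**
(`blockAvg₂ su2GroupMean expMeanLogSU`), hypothesis-free. [folklore] -/
theorem haarAC_avgFun₂_su2GroupMean_expMeanLogSU (F : T4Family) (K k : ℕ) (hk : k < K) :
    @T4FiniteEpsInhabited.HaarAC (F.P K) k (Matrix.specialUnitaryGroup (Fin 2) ℂ) _ _ _ (avgFun₂ su2GroupMean expMeanLogSU) :=
  haarAC_avgFun₂_expMeanLogSU su2GroupMean measurable_su2GroupMean_M F K k hk

/-- And finite-`ε` data on `SU(2)` averaging by `blockAvg₂ su2GroupMean expMeanLogSU` EXIST with the reflection-positivity and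
torus-covariance targets in both forms (stub inhabitant; (B) fails there). [folklore] -/
theorem exists_blockAvg₂_su2GroupMean_expMeanLogSU_rp_and_cov (F : T4Family) :
    ∃ D : T4Continuum.FiniteEpsData F (Matrix.specialUnitaryGroup (Fin 2) ℂ),
      (∀ K j, D.av K j = blockAvg₂ su2GroupMean expMeanLogSU) ∧
      (D.limit_reflectionPositive' ∧ D.limit_reflectionPositive) ∧ (D.limit_torusCovariant' ∧ D.limit_torusCovariant) :=
  exists_blockAvg₂_expMeanLogSU_rp_and_cov su2GroupMean measurable_su2GroupMean_M F

end SU2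

end BlockAveragingTwoLevelEMLHaarAC

end Literature.MathematicalPhysics.QuantumFieldTheory.Balaban1983to89

end
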